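import Literature.AlgebraicGeometry.HodgeTheory.NodalPencilMonodromyMap
import Literature.AlgebraicGeometry.HodgeTheory.WeightedPencilModelIsotopy
import Literature.AlgebraicGeometry.HodgeTheory.CyclicCoverPencilSlice
import Literature.AlgebraicGeometry.HodgeTheory.CyclicCoverPencilModelIsotopyRadius
import Literature.Geometry.Manifold.ShellInterpolatedIsotopyPunctured
import Literature.Geometry.Manifold.ShellInterpolatedIsotopyInverse
import Mathlib.Analysis.SpecialFunctions.SmoothTransition
import HarnessLib

/-!
# The geometric monodromy map of a monomial pencil near an isolated singular point of Pham–Brieskorn type (arbitrary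
# weights), on the pencil slice (shell interpolation of the model isotopy and the fold isotopy)

Family `hodge`, layer `Literature/AlgebraicGeometry/HodgeTheory`; theorems only (no definition, no named fact). Written by the
prover seat `hodge-nonav-20241-p1` (g19, cell `hodge-nonav`) as brick 4 of the port B4c of the programme «A₃-TRACE» (memo
`HOME/memos/PROGRAMME-A3-TRACE-Bx-g16.md` §3; binder hN `stub_a3NonComm` of crux K1-B `VeryGeneralSignCommutatorsInHg`,
stmt-HodgeConjecture-19716): the WEIGHTED twin of prover-Bx's `NodalPencilMonodromyMap` (all weights `2`). The classical construction
of the geometric monodromy of the pencil around its singular member (Arnold–Gusein-Zade–Varchenko II Part I §1.1, §2.1; Milnor §9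
Lemma 9.4) assembled on the pencil slice `S = NodalPencil.pencilSlice n d i b₀ ⊆ 𝒴°(ℂ)` from
* the MODEL isotopy `J(θ, x) = chartModelIsotopy a Φ Θ θ x` for a weight vector `a` (all `aⱼ ≠ 0`) and a chart `Θ` with
  `Σⱼ (Θ y)ⱼ^{aⱼ} = φ(y)` (`WeightedPencilModelIsotopy`), read as a self-map of `S` through `restrictIf`;
* a FOLD isotopy `g` of `𝒴°(ℂ)` (the output of `WeightedPencilFoldIsotopy.exists_pencil_foldIsotopy_invariant`, taken here as data with
  its seven properties), which preserves the slice;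
* prover-Bx's radius function `NodalPencil.cutRadius` and the fold-isotopy slice lemmas `NodalPencil.monodromyMap_hgO / _hgadd / _hgρ /
  _hgcont / _cutRadius_eq / _good_of_cutRadius_lt` (they do not mention the weights and are reused VERBATIM),
by the punctured shell interpolation `Geometry/Manifold/ShellInterpolatedIsotopyPunctured` (radii `s₁² ≤ t₁ < t₂ ≤ T' < T`, disc
`|c| < δ₀ ≤ ρW/4`).

* `monodromyMap_good`, `monodromyMap_model_spec`, `monodromyMap_model_coe`, `monodromyMap_hI`, `_hI0`, `_hIadd`, `_hIcont` (the model
  isotopy on the slice satisfies the hypotheses of the shell interpolation; proofs verbatim those of the nodal file with `2 ↦ aⱼ`);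
* `exists_pencil_monodromyMap` — **self-maps `h, k, H` of `ℝ × S` with, over the punctured disc `0 < |c| < δ₀`: `h` continuous,
  `h(0, ·) = id`, `c(h(u, x)) = e^{2πiu} c(x)`, `F` preserved below `T` and kept above `T'`, `k(u, ·)` a two-sided inverse of `h(u, ·)`,
  `h(1, ·) = id` where `F ≥ t₂`, and the homotopy `H(s, ·)` inside each fibre-ball `{c = const, F < T}` from `H(0, ·) = J(2π, ·)` (the
  WEIGHTED ROTATION `(e^{2πi/aⱼ} zⱼ)ⱼ` of the chart coordinates) to `H(1, ·) = h(1, ·)` (where `F ≤ T'`).**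

Everything is proved; no definitions, no named facts. Honest scope: plumbing of the classical construction of the geometric monodromy
of a pencil near an isolated weighted-homogeneous singular point; nothing here says HC or any rung is proved.

## References

* [ArnoldGuseinzadeVarchenko2012] V. I. Arnold, S. M. Gusein-Zade, A. N. Varchenko, Singularities of Differentiable Maps II (2012),
  Part I §1.1, §2.1, §2.3.
* [Milnor1968] J. Milnor, Singular Points of Complex Hypersurfaces, §9 Lemma 9.4, p. 77.
-/

noncomputable section

open CategoryTheory AlgebraicGeometry MvPolynomial TopologicalSpace Set Topology Filter Complex
open scoped Manifold ContDiff Real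
open Literature.AlgebraicGeometry.Motives Literature.AlgebraicGeometry.Motives.UniversalHypersurface
open Literature.AlgebraicGeometry.HodgeTheory.UniversalHypersurface Literature.Geometry.ComplexAnalytic Literature.Geometry.Manifold

namespace Literature.AlgebraicGeometry.HodgeTheory

namespace WeightedPencil

section MonodromyMap

variable {n d : ℕ} {i : Fin (n + 2)} (a : Fin (n + 1) → ℕ) (ha : ∀ j, a j ≠ 0) (hd : 0 < d) (b₀ : DegIndex n d → ℂ)
  (Φ : OpenPartialHomeomorph (ComplexPoints (regularTotal ℂ n d)) (({m : DegIndex n d // m ≠ regPowIndex n d i} ⊕ Fin (n + 1)) → ℂ))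
  (hΦ : ⇑Φ = regChartFun n d i) (hΦs : Φ.source = regChartDom n d i) (hΦt : Φ.target = regChartFun n d i '' regChartDom n d i)
  (Θ : OpenPartialHomeomorph (Fin (n + 1) → ℂ) (Fin (n + 1) → ℂ)) {r R''' R'' : ℝ}
  (hr : {z : Fin (n + 1) → ℂ | ∑ j, ‖z j‖ ^ 2 ≤ r ^ 2} ⊆ Θ.target)
  (φ : (Fin (n + 1) → ℂ) → ℂ)
  (hφ : ∀ y, φ y = regChartCoeffVec n d i
    (Sum.elim (fun m : {m : DegIndex n d // m ≠ regPowIndex n d i} => b₀ m.1) y) (regPowIndex n d i) - b₀ (regPowIndex n d i))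
  (hΘφ : ∀ y ∈ Θ.source, ∑ j, (Θ y j) ^ a j = φ y)
  {ρW : ℝ} (hρW : 0 < ρW)
  (hns : ∀ c : ℂ, c ≠ 0 → ‖c‖ < ρW →
    SmoothHypersurface.IsNonsingularForm ℂ (formOfCoeffs (b₀ + Pi.single (regPowIndex n d i) c)))
  (hR : R''' < R'') {T : ℝ} (hTR : T ≤ R''') (hTr : T ≤ r ^ 2)
include ha hd hΦ hΦs hΦt hr hφ hΘφ hρW hns hR hTR hTr

/-! ### The model isotopy at the good points of the slice -/

omit hρW in
/-- **The data of a good point**: `x ∈ S`, `F(x) < T`, `0 < |c(x)| < ρW` ⇒ `x ∈ Φ.source`, `y(x) ∈ Θ.source`, `Σ|Θ y(x)|² < r²`,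
`Σ|Θ y(x)|² ≤ R'''`. [cite: Milnor1968, §9 Lemma 9.4] -/
theorem monodromyMap_good {x : ComplexPoints (regularTotal ℂ n d)} (hxS : x ∈ NodalPencil.pencilSlice n d i b₀)
    (hF : NodalPencil.satRadius n d i Θ R''' R'' x < T) (hc0 : NodalPencil.pencilCoord n d i b₀ x ≠ 0) (hcρ : ‖NodalPencil.pencilCoord n d i b₀ x‖ < ρW) :
    x ∈ Φ.source ∧ (fun j => regChartFun n d i x (Sum.inr j)) ∈ Θ.source ∧
      ∑ k, ‖Θ (fun j => regChartFun n d i x (Sum.inr j)) k‖ ^ 2 < r ^ 2 ∧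
      ∑ k, ‖Θ (fun j => regChartFun n d i x (Sum.inr j)) k‖ ^ 2 ≤ R''' := by
  obtain ⟨hx, hy, hyr, -⟩ := mem_goodSet_of_satRadius_lt a ha hd b₀ Φ hΦ hΦs hΦt Θ hr φ hφ hΘφ hns hR hTR hTr hxS hF hc0 hcρ
  obtain ⟨-, -, hSig⟩ := NodalPencil.mem_of_satRadius_lt n d i Θ R''' R'' hR (lt_of_lt_of_le hF hTR)
  rw [hΦ] at hy hyr
  exact ⟨hx, hy, hyr, by rw [hSig]; exact (lt_of_lt_of_le hF hTR).le⟩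

omit hρW in
/-- **At a good point the model isotopy stays in the slice, with `c ↦ e^{iθ}c` and `F` preserved.**
[cite: Milnor1968, §9 Lemma 9.4] [cite: ArnoldGuseinzadeVarchenko2012, Part I §2.1] -/
theorem monodromyMap_model_spec {x : ComplexPoints (regularTotal ℂ n d)} (hxS : x ∈ NodalPencil.pencilSlice n d i b₀)
    (hF : NodalPencil.satRadius n d i Θ R''' R'' x < T) (hc0 : NodalPencil.pencilCoord n d i b₀ x ≠ 0) (hcρ : ‖NodalPencil.pencilCoord n d i b₀ x‖ < ρW)
    (θ : ℝ) :
    chartModelIsotopy a Φ Θ θ x ∈ NodalPencil.pencilSlice n d i b₀ ∧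
      NodalPencil.pencilCoord n d i b₀ (chartModelIsotopy a Φ Θ θ x) =
        Complex.exp ((θ : ℂ) * I) * NodalPencil.pencilCoord n d i b₀ x ∧
      NodalPencil.satRadius n d i Θ R''' R'' (chartModelIsotopy a Φ Θ θ x) = NodalPencil.satRadius n d i Θ R''' R'' x := by
  obtain ⟨hx, hy, hyr, hyR⟩ := monodromyMap_good a ha hd b₀ Φ hΦ hΦs hΦt Θ hr φ hφ hΘφ hns hR hTR hTr hxS hF hc0 hcρ
  exact ⟨chartModelIsotopy_mem_pencilSlice a ha hd b₀ Φ hΦ hΦs hΦt Θ hr φ hφ hΘφ hns hx hxS hy hyr hc0 hcρ θ,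
    pencilCoord_chartModelIsotopy a ha hd b₀ Φ hΦ hΦs hΦt Θ hr φ hφ hΘφ hns hx hxS hy hyr hc0 hcρ θ,
    satRadius_chartModelIsotopy a ha hd b₀ Φ hΦ hΦs hΦt Θ hr φ hφ hΘφ hns hx hxS hy hyr hc0 hcρ θ hR hyR⟩

omit hρW in
/-- **On the slice, as a self-map**: at a good point `restrictIf S (J θ) x = J(θ, x)`. [cite: Milnor1968, §9 Lemma 9.4] -/
theorem monodromyMap_model_coe {x : NodalPencil.pencilSlice n d i b₀}
    (hF : NodalPencil.satRadius n d i Θ R''' R'' x.1 < T) (hc0 : NodalPencil.pencilCoord n d i b₀ x.1 ≠ 0) (hcρ : ‖NodalPencil.pencilCoord n d i b₀ x.1‖ < ρW)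
    (θ : ℝ) :
    (restrictIf (NodalPencil.pencilSlice n d i b₀) (chartModelIsotopy a Φ Θ θ) x :
        ComplexPoints (regularTotal ℂ n d)) = chartModelIsotopy a Φ Θ θ x.1 :=
  restrictIf_coe _ _ (monodromyMap_model_spec a ha hd b₀ Φ hΦ hΦs hΦt Θ hr φ hφ hΘφ hns hR hTR hTr x.2 hF hc0 hcρ θ).1

/-- **Hypothesis `hI` of the shell interpolation** for `J` read on the slice with `ρ = NodalPencil.cutRadius`, `p = c`.
[cite: ArnoldGuseinzadeVarchenko2012, Part I §1.1] [cite: Milnor1968, §9 Lemma 9.4] -/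
theorem monodromyMap_hI (θ : ℝ) (x : NodalPencil.pencilSlice n d i b₀) (hρ : NodalPencil.cutRadius n d i Θ R''' R'' b₀ T ρW x.1 < T)
    (hc0 : NodalPencil.pencilCoord n d i b₀ x.1 ≠ 0) :
    NodalPencil.cutRadius n d i Θ R''' R'' b₀ T ρW
        (restrictIf (NodalPencil.pencilSlice n d i b₀) (chartModelIsotopy a Φ Θ θ) x).1 =
        NodalPencil.cutRadius n d i Θ R''' R'' b₀ T ρW x.1 ∧
      NodalPencil.pencilCoord n d i b₀ (restrictIf (NodalPencil.pencilSlice n d i b₀) (chartModelIsotopy a Φ Θ θ) x).1 =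
        Complex.exp ((θ : ℂ) * I) * NodalPencil.pencilCoord n d i b₀ x.1 := by
  obtain ⟨hF, hcρ⟩ := NodalPencil.monodromyMap_good_of_cutRadius_lt b₀ Θ hρW hρ
  obtain ⟨-, hc, hFJ⟩ := monodromyMap_model_spec a ha hd b₀ Φ hΦ hΦs hΦt Θ hr φ hφ hΘφ hns hR hTR hTr x.2 hF hc0 hcρ θ
  rw [monodromyMap_model_coe a ha hd b₀ Φ hΦ hΦs hΦt Θ hr φ hφ hΘφ hns hR hTR hTr hF hc0 hcρ θ]
  refine ⟨NodalPencil.cutRadius_congr n d i Θ R''' R'' b₀ T ρW hFJ ?_, hc⟩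
  rw [hc, norm_mul, Complex.norm_exp_ofReal_mul_I, one_mul]

/-- **Hypothesis `hI0`**: `J(0, ·) = id` on the ball over the punctured plane. [cite: Milnor1968, §9 Lemma 9.4] -/
theorem monodromyMap_hI0 (x : NodalPencil.pencilSlice n d i b₀) (hρ : NodalPencil.cutRadius n d i Θ R''' R'' b₀ T ρW x.1 < T)
    (hc0 : NodalPencil.pencilCoord n d i b₀ x.1 ≠ 0) :
    restrictIf (NodalPencil.pencilSlice n d i b₀) (chartModelIsotopy a Φ Θ 0) x = x := by
  obtain ⟨hF, hcρ⟩ := NodalPencil.monodromyMap_good_of_cutRadius_lt b₀ Θ hρW hρ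
  obtain ⟨hx, hy, -⟩ := monodromyMap_good a ha hd b₀ Φ hΦ hΦs hΦt Θ hr φ hφ hΘφ hns hR hTR hTr x.2 hF hc0 hcρ
  refine restrictIf_of_apply_eq _ _ ?_
  rw [← hΦ] at hy
  exact chartModelIsotopy_zero_of_mem a Φ Θ hx hy

/-- **Hypothesis `hIadd`**: the flow law of `J` on the ball over the punctured plane. [cite: Milnor1968, §9 Lemma 9.4] -/
theorem monodromyMap_hIadd (θ θ' : ℝ) (x : NodalPencil.pencilSlice n d i b₀) (hρ : NodalPencil.cutRadius n d i Θ R''' R'' b₀ T ρW x.1 < T)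
    (hc0 : NodalPencil.pencilCoord n d i b₀ x.1 ≠ 0) :
    restrictIf (NodalPencil.pencilSlice n d i b₀) (chartModelIsotopy a Φ Θ (θ + θ')) x =
      restrictIf (NodalPencil.pencilSlice n d i b₀) (chartModelIsotopy a Φ Θ θ)
        (restrictIf (NodalPencil.pencilSlice n d i b₀) (chartModelIsotopy a Φ Θ θ') x) := by
  obtain ⟨hF, hcρ⟩ := NodalPencil.monodromyMap_good_of_cutRadius_lt b₀ Θ hρW hρ
  obtain ⟨hx, hy, hyr, -⟩ := monodromyMap_good a ha hd b₀ Φ hΦ hΦs hΦt Θ hr φ hφ hΘφ hns hR hTR hTr x.2 hF hc0 hcρ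
  obtain ⟨-, hc', hF'⟩ := monodromyMap_model_spec a ha hd b₀ Φ hΦ hΦs hΦt Θ hr φ hφ hΘφ hns hR hTR hTr x.2 hF hc0 hcρ θ'
  have hF'' : NodalPencil.satRadius n d i Θ R''' R''
      (restrictIf (NodalPencil.pencilSlice n d i b₀) (chartModelIsotopy a Φ Θ θ') x).1 < T := by
    rw [monodromyMap_model_coe a ha hd b₀ Φ hΦ hΦs hΦt Θ hr φ hφ hΘφ hns hR hTR hTr hF hc0 hcρ θ', hF']; exact hF
  have hc0'' : NodalPencil.pencilCoord n d i b₀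
      (restrictIf (NodalPencil.pencilSlice n d i b₀) (chartModelIsotopy a Φ Θ θ') x).1 ≠ 0 := by
    rw [monodromyMap_model_coe a ha hd b₀ Φ hΦ hΦs hΦt Θ hr φ hφ hΘφ hns hR hTR hTr hF hc0 hcρ θ', hc']
    exact mul_ne_zero (Complex.exp_ne_zero _) hc0
  have hcρ'' : ‖NodalPencil.pencilCoord n d i b₀
      (restrictIf (NodalPencil.pencilSlice n d i b₀) (chartModelIsotopy a Φ Θ θ') x).1‖ < ρW := by
    rw [monodromyMap_model_coe a ha hd b₀ Φ hΦ hΦs hΦt Θ hr φ hφ hΘφ hns hR hTR hTr hF hc0 hcρ θ', hc', norm_mul,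
      Complex.norm_exp_ofReal_mul_I, one_mul]; exact hcρ
  apply Subtype.ext
  rw [monodromyMap_model_coe a ha hd b₀ Φ hΦ hΦs hΦt Θ hr φ hφ hΘφ hns hR hTR hTr hF hc0 hcρ,
    monodromyMap_model_coe a ha hd b₀ Φ hΦ hΦs hΦt Θ hr φ hφ hΘφ hns hR hTR hTr hF'' hc0'' hcρ'',
    monodromyMap_model_coe a ha hd b₀ Φ hΦ hΦs hΦt Θ hr φ hφ hΘφ hns hR hTR hTr hF hc0 hcρ]
  exact chartModelIsotopy_add a ha hd b₀ Φ hΦ hΦs hΦt Θ hr φ hφ hΘφ hns hx x.2 hy hyr hc0 hcρ θ' θ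

/-- **Hypothesis `hIcont`**: `(θ, x) ↦ J(θ, x)` is continuous on `ℝ × ({NodalPencil.cutRadius < T} ∩ {c ≠ 0})` (as a map of the slice).
[cite: Milnor1968, §9 Lemma 9.4] -/
theorem monodromyMap_hIcont :
    ContinuousOn (fun q : ℝ × NodalPencil.pencilSlice n d i b₀ =>
        restrictIf (NodalPencil.pencilSlice n d i b₀) (chartModelIsotopy a Φ Θ q.1) q.2)
      (univ ×ˢ {x : NodalPencil.pencilSlice n d i b₀ | NodalPencil.cutRadius n d i Θ R''' R'' b₀ T ρW x.1 < T ∧ NodalPencil.pencilCoord n d i b₀ x.1 ≠ 0}) := by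
  have key : ContinuousOn (fun q : ℝ × NodalPencil.pencilSlice n d i b₀ =>
      chartModelIsotopy a Φ Θ q.1 q.2.1)
      (univ ×ˢ {x : NodalPencil.pencilSlice n d i b₀ | NodalPencil.cutRadius n d i Θ R''' R'' b₀ T ρW x.1 < T ∧ NodalPencil.pencilCoord n d i b₀ x.1 ≠ 0}) := by
    refine (continuousOn_chartModelIsotopy a Φ Θ hr).comp
      (continuous_fst.prodMk (continuous_subtype_val.comp continuous_snd)).continuousOn ?_
    rintro ⟨θ, x⟩ ⟨-, hρ, hc0⟩
    obtain ⟨hF, hcρ⟩ := NodalPencil.monodromyMap_good_of_cutRadius_lt b₀ Θ hρW hρ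
    obtain ⟨hx, hy, hyr, hθ⟩ := mem_goodSet_of_satRadius_lt a ha hd b₀ Φ hΦ hΦs hΦt Θ hr φ hφ hΘφ hns hR hTR hTr x.2 hF hc0 hcρ
    exact ⟨mem_univ _, hx, hy, hyr, hθ⟩
  rw [Topology.IsInducing.subtypeVal.continuousOn_iff]
  refine key.congr ?_
  rintro ⟨θ, x⟩ ⟨-, hρ, hc0⟩
  obtain ⟨hF, hcρ⟩ := NodalPencil.monodromyMap_good_of_cutRadius_lt b₀ Θ hρW hρ
  exact monodromyMap_model_coe a ha hd b₀ Φ hΦ hΦs hΦt Θ hr φ hφ hΘφ hns hR hTR hTr hF hc0 hcρ θ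

/-! ### The fold isotopy on the slice -/

variable (hT0 : 0 < T) (g : ℝ × ComplexPoints (regularTotal ℂ n d) → ComplexPoints (regularTotal ℂ n d)) (hgc : Continuous g)
  (hg0 : ∀ q, g (0, q) = q) (hg2π : ∀ q, g (2 * π, q) = q) {s₀ s₁ r₂ : ℝ}
  (hgO : ∀ θ, ∀ q ∈ NodalPencil.invariantSet n d i Θ R''' R'' b₀ s₁, ‖NodalPencil.pencilCoord n d i b₀ q‖ < ρW →
    g (θ, q) ∈ NodalPencil.invariantSet n d i Θ R''' R'' b₀ s₁ ∧
      NodalPencil.pencilCoord n d i b₀ (g (θ, q)) = Complex.exp (θ * I) * NodalPencil.pencilCoord n d i b₀ q)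
  (hgadd : ∀ θ θ', ∀ q ∈ NodalPencil.invariantSet n d i Θ R''' R'' b₀ s₁, ‖NodalPencil.pencilCoord n d i b₀ q‖ < ρW →
    g (θ + θ', q) = g (θ, g (θ', q)))
  (hgS : ∀ θ q, q ∈ NodalPencil.pencilSlice n d i b₀ → g (θ, q) ∈ NodalPencil.pencilSlice n d i b₀)
  (hgF : ∀ θ q, q ∈ NodalPencil.pencilSlice n d i b₀ → s₀ ^ 2 < NodalPencil.satRadius n d i Θ R''' R'' q → NodalPencil.satRadius n d i Θ R''' R'' q < r₂ ^ 2 →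
    NodalPencil.satRadius n d i Θ R''' R'' (g (θ, q)) = NodalPencil.satRadius n d i Θ R''' R'' q)
  (hs₀₁ : s₀ ^ 2 < s₁ ^ 2) (hTr₂ : T ≤ r₂ ^ 2) {δ₀ : ℝ} (hδ₀ : δ₀ ≤ ρW / 4)
include hT0 hgc hg0 hg2π hgO hgadd hgS hgF hs₀₁ hTr₂ hδ₀

/-! ### The monodromy map -/

/-- **The geometric monodromy map of a monomial pencil near a weighted-homogeneous (Pham–Brieskorn) critical point, on the
slice** (weights `a`; the nodal case is `a = (2, …, 2)`). Radii `s₁² ≤ t₁ < t₂ ≤ T' < T`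
(`T ≤ min(R''', r², r₂²)`), disc `|c| < δ₀ ≤ ρW/4`. There are self-maps `h, k, H` of `ℝ × S` such that, at the points `x ∈ S` with
`c(x) ≠ 0` (and `|c(x)| < δ₀` where indicated): `h` is continuous on `ℝ × {c ≠ 0}`; `h(0, x) = x`; `c(h(u, x)) = e^{2πiu} c(x)`,
`F(h(u, x)) = F(x)` if `F(x) < T`, `F(h(u, x)) > T'` if `F(x) > T'`; `k(u, ·)` is a two-sided inverse of `h(u, ·)` covering the
rotation `c ↦ e^{−2πiu} c` and preserving `F` below `T` (so `h(u, ·) : X_c → X_{e^{2πiu}c}` is a bijection); `h(1, x) = x` if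
`F(x) ≥ t₂`; and `H` is continuous on `ℝ × {F < T, 0 < |c| < δ₀}` with `c(H(s, x)) = c(x)`, `F(H(s, x)) = F(x)`, `H(0, x) = J(2π, x)`
(the WEIGHTED model monodromy `chartModelIsotopy a Φ Θ (2π)`, i.e. `Φ⁻¹(b'(x), Θ⁻¹(R_{2π} Θ y(x)))` with `R_θ` the weighted
rotation `y_j ↦ e^{iθ/a_j} y_j` of Milnor's Lemma 9.4 — for the nodal weights the antipodal map `−Θ y(x)`) and `H(1, x) = h(1, x)` if
`F(x) ≤ T'`.
[cite: ArnoldGuseinzadeVarchenko2012, Part I §1.1 and §2.1] [cite: Milnor1968, §9 Lemma 9.4] -/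
theorem exists_pencil_monodromyMap (hΘ : ContDiffOn ℝ ∞ Θ Θ.source)
    (hR'' : {z : Fin (n + 1) → ℂ | ∑ j, ‖z j‖ ^ 2 ≤ R''} ⊆ Θ.target)
    {t₁ t₂ T' : ℝ} (ht₁ : s₁ ^ 2 ≤ t₁) (ht₁₂ : t₁ < t₂) (ht₂ : t₂ ≤ T') (hT' : T' < T) :
    ∃ h k H : ℝ × NodalPencil.pencilSlice n d i b₀ → NodalPencil.pencilSlice n d i b₀,
      (Continuous fun ux : ℝ × {x : NodalPencil.pencilSlice n d i b₀ // NodalPencil.pencilCoord n d i b₀ x.1 ≠ 0} => h (ux.1, ux.2.1)) ∧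
      (∀ x, NodalPencil.pencilCoord n d i b₀ x.1 ≠ 0 → h (0, x) = x) ∧
      (∀ u x, NodalPencil.pencilCoord n d i b₀ x.1 ≠ 0 → ‖NodalPencil.pencilCoord n d i b₀ x.1‖ < δ₀ →
        NodalPencil.pencilCoord n d i b₀ (h (u, x)).1 = Complex.exp (((2 * π * u : ℝ) : ℂ) * I) * NodalPencil.pencilCoord n d i b₀ x.1 ∧
        (NodalPencil.satRadius n d i Θ R''' R'' x.1 < T → NodalPencil.satRadius n d i Θ R''' R'' (h (u, x)).1 = NodalPencil.satRadius n d i Θ R''' R'' x.1) ∧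
        (T' < NodalPencil.satRadius n d i Θ R''' R'' x.1 → T' < NodalPencil.satRadius n d i Θ R''' R'' (h (u, x)).1) ∧
        k (u, h (u, x)) = x ∧ h (u, k (u, x)) = x ∧
        NodalPencil.pencilCoord n d i b₀ (k (u, x)).1 = Complex.exp (((-(2 * π * u) : ℝ) : ℂ) * I) * NodalPencil.pencilCoord n d i b₀ x.1 ∧
        (NodalPencil.satRadius n d i Θ R''' R'' x.1 < T → NodalPencil.satRadius n d i Θ R''' R'' (k (u, x)).1 = NodalPencil.satRadius n d i Θ R''' R'' x.1)) ∧
      (∀ x, NodalPencil.pencilCoord n d i b₀ x.1 ≠ 0 → ‖NodalPencil.pencilCoord n d i b₀ x.1‖ < δ₀ → t₂ ≤ NodalPencil.satRadius n d i Θ R''' R'' x.1 →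
        h (1, x) = x) ∧
      ContinuousOn H (univ ×ˢ {x : NodalPencil.pencilSlice n d i b₀ |
        NodalPencil.satRadius n d i Θ R''' R'' x.1 < T ∧ NodalPencil.pencilCoord n d i b₀ x.1 ≠ 0 ∧ ‖NodalPencil.pencilCoord n d i b₀ x.1‖ < δ₀}) ∧
      (∀ s x, NodalPencil.pencilCoord n d i b₀ x.1 ≠ 0 → ‖NodalPencil.pencilCoord n d i b₀ x.1‖ < δ₀ → NodalPencil.satRadius n d i Θ R''' R'' x.1 < T →
        NodalPencil.pencilCoord n d i b₀ (H (s, x)).1 = NodalPencil.pencilCoord n d i b₀ x.1 ∧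
        NodalPencil.satRadius n d i Θ R''' R'' (H (s, x)).1 = NodalPencil.satRadius n d i Θ R''' R'' x.1 ∧
        (H (0, x)).1 = chartModelIsotopy a Φ Θ (2 * π) x.1 ∧
        (NodalPencil.satRadius n d i Θ R''' R'' x.1 ≤ T' → H (1, x) = h (1, x))) := by
  -- the data of `ShellInterpolatedIsotopyPunctured` on `M = S`
  let ρ : NodalPencil.pencilSlice n d i b₀ → ℝ := fun x => NodalPencil.cutRadius n d i Θ R''' R'' b₀ T ρW x.1
  let pc : NodalPencil.pencilSlice n d i b₀ → ℂ := fun x => NodalPencil.pencilCoord n d i b₀ x.1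
  let J : ℝ × NodalPencil.pencilSlice n d i b₀ → NodalPencil.pencilSlice n d i b₀ := fun q =>
    restrictIf (NodalPencil.pencilSlice n d i b₀) (chartModelIsotopy a Φ Θ q.1) q.2
  let G : ℝ × NodalPencil.pencilSlice n d i b₀ → NodalPencil.pencilSlice n d i b₀ := fun q =>
    restrictIf (NodalPencil.pencilSlice n d i b₀) (fun x => g (q.1, x)) q.2
  let lam : ℝ → ℝ := fun t => Real.smoothTransition ((t - t₁) / (t₂ - t₁))
  have hρc : Continuous ρ :=
    (NodalPencil.continuous_cutRadius n d i Θ R''' R'' b₀ T ρW hd hΘ hR hR'').comp continuous_subtype_val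
  have hlam : Continuous lam :=
    Real.smoothTransition.continuous.comp ((continuous_id.sub continuous_const).div_const _)
  have hlam₀ : ∀ t, t ≤ t₁ → lam t = 0 := fun t ht =>
    Real.smoothTransition.zero_of_nonpos (div_nonpos_of_nonpos_of_nonneg (by linarith) (by linarith))
  have hlam₁ : ∀ t, t₂ ≤ t → lam t = 1 := fun t ht =>
    Real.smoothTransition.one_of_one_le (by rw [le_div_iff₀ (by linarith)]; linarith)
  have hI : ∀ θ x, ρ x < T → pc x ≠ 0 → ρ (J (θ, x)) = ρ x ∧ pc (J (θ, x)) = Complex.exp ((θ : ℂ) * I) * pc x :=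
    fun θ x hρ hc0 => monodromyMap_hI a ha hd b₀ Φ hΦ hΦs hΦt Θ hr φ hφ hΘφ hρW hns hR hTR hTr θ x hρ hc0
  have hI0 : ∀ x, ρ x < T → pc x ≠ 0 → J (0, x) = x :=
    fun x hρ hc0 => monodromyMap_hI0 a ha hd b₀ Φ hΦ hΦs hΦt Θ hr φ hφ hΘφ hρW hns hR hTR hTr x hρ hc0
  have hIadd : ∀ θ θ' x, ρ x < T → pc x ≠ 0 → J (θ + θ', x) = J (θ, J (θ', x)) :=
    fun θ θ' x hρ hc0 => monodromyMap_hIadd a ha hd b₀ Φ hΦ hΦs hΦt Θ hr φ hφ hΘφ hρW hns hR hTR hTr θ θ' x hρ hc0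
  have hIcont : ContinuousOn J (univ ×ˢ {x | ρ x < T ∧ pc x ≠ 0}) :=
    monodromyMap_hIcont a ha hd b₀ Φ hΦ hΦs hΦt Θ hr φ hφ hΘφ hρW hns hR hTR hTr
  have hG0 : ∀ q, G (0, q) = q := fun q => restrictIf_of_apply_eq _ _ (hg0 q.1)
  have hG2π : ∀ q, G (2 * π, q) = q := fun q => restrictIf_of_apply_eq _ _ (hg2π q.1)
  have hGO : ∀ θ q, s₁ ^ 2 < ρ q → ‖pc q‖ < δ₀ → s₁ ^ 2 < ρ (G (θ, q)) ∧ pc (G (θ, q)) = Complex.exp ((θ : ℂ) * I) * pc q :=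
    fun θ q hρ hq => NodalPencil.monodromyMap_hgO b₀ Θ hρW hR hTR hT0 g hgO hgS hδ₀ θ q hρ hq
  have hGadd : ∀ θ θ' q, s₁ ^ 2 < ρ q → ‖pc q‖ < δ₀ → G (θ + θ', q) = G (θ, G (θ', q)) :=
    fun θ θ' q hρ hq => NodalPencil.monodromyMap_hgadd b₀ Θ hρW hR hTR hT0 g hgadd hgS hδ₀ θ θ' q hρ hq
  have hGρ : ∀ θ q, s₁ ^ 2 < ρ q → ‖pc q‖ < δ₀ → ρ q < T → ρ (G (θ, q)) = ρ q :=
    fun θ q hρ hq hρT => NodalPencil.monodromyMap_hgρ b₀ Θ hρW hR hTR hT0 g hgO hgS hgF hs₀₁ hTr₂ hδ₀ θ q hρ hq hρT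
  have hGcont : Continuous G := NodalPencil.monodromyMap_hgcont b₀ g hgc hgS
  have hs₀₁' : s₁ ^ 2 ≤ t₁ := ht₁
  -- the three maps
  refine ⟨fun ux => if ρ ux.2 ≤ T' then G (2 * π * ux.1 * lam (ρ ux.2), J (2 * π * ux.1 * (1 - lam (ρ ux.2)), ux.2))
      else G (2 * π * ux.1, ux.2),
    fun ux => if ρ ux.2 ≤ T' then J (-(2 * π * ux.1 * (1 - lam (ρ ux.2))), G (-(2 * π * ux.1 * lam (ρ ux.2)), ux.2))
      else G (-(2 * π * ux.1), ux.2),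
    fun sx => G (2 * π * sx.1 * lam (ρ sx.2), J (2 * π * (1 - sx.1 * lam (ρ sx.2)), sx.2)),
    ?_, ?_, ?_, ?_, ?_, ?_⟩
  · exact continuous_shellIsotopy' hρc ht₂ hT' hlam hlam₁ hIcont hI0 hGcont
  · intro x hx0
    exact shellIsotopy_zero' (lam := lam) hT' hI0 hG0 hx0
  · intro u x hx0 hxδ
    have hρx : ρ x = NodalPencil.satRadius n d i Θ R''' R'' x.1 := NodalPencil.monodromyMap_cutRadius_eq b₀ Θ hρW hR hTR hT0 hδ₀ hxδ
    obtain ⟨hpc, hρ₁, hρ₂⟩ := apply_shellIsotopy' hs₀₁' ht₁₂ ht₂ hT' hlam₀ hI hG0 hGO hGadd hGρ u hxδ hx0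
    have hnorm : ‖pc (if ρ x ≤ T' then G (2 * π * u * lam (ρ x), J (2 * π * u * (1 - lam (ρ x)), x))
        else G (2 * π * u, x))‖ < δ₀ := by
      rw [hpc, norm_mul, Complex.norm_exp_ofReal_mul_I, one_mul]; exact hxδ
    have hρh := NodalPencil.monodromyMap_cutRadius_eq b₀ Θ hρW hR hTR hT0 hδ₀ hnorm
    obtain ⟨hpk, hρk⟩ := apply_shellInverse' hs₀₁' ht₁₂ ht₂ hT' hlam₀ hI hG0 hGO hGρ u hxδ hx0
    have hnormk : ‖pc (if ρ x ≤ T' then J (-(2 * π * u * (1 - lam (ρ x))), G (-(2 * π * u * lam (ρ x)), x))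
        else G (-(2 * π * u), x))‖ < δ₀ := by
      rw [hpk, norm_mul, Complex.norm_exp_ofReal_mul_I, one_mul]; exact hxδ
    have hρhk := NodalPencil.monodromyMap_cutRadius_eq b₀ Θ hρW hR hTR hT0 hδ₀ hnormk
    refine ⟨hpc, fun hF => ?_, fun hF => ?_, ?_, ?_, hpk, fun hF => ?_⟩
    · have h := hρ₁ (by rw [hρx]; exact hF)
      exact hρh.symm.trans (h.trans hρx)
    · have h := hρ₂ (by rw [hρx]; exact hF)
      exact lt_of_lt_of_eq h hρh
    · exact shellIsotopy_leftInverse' hs₀₁' ht₁₂ ht₂ hT' hlam₀ hI hI0 hIadd hG0 hGO hGadd hGρ u hxδ hx0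
    · exact shellIsotopy_rightInverse' hs₀₁' ht₁₂ ht₂ hT' hlam₀ hI hI0 hIadd hG0 hGO hGadd hGρ u hxδ hx0
    · have h := hρk (by rw [hρx]; exact hF)
      exact hρhk.symm.trans (h.trans hρx)
  · intro x hx0 hxδ hF
    have hρx : ρ x = NodalPencil.satRadius n d i Θ R''' R'' x.1 := NodalPencil.monodromyMap_cutRadius_eq b₀ Θ hρW hR hTR hT0 hδ₀ hxδ
    exact shellIsotopy_one_of_ge' hT' hlam₁ hI0 hG2π (by rw [hρx]; exact hF) hx0
  · refine (continuousOn_shellHomotopy' hρc hlam hIcont hGcont).mono (prod_mono le_rfl ?_)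
    rintro x ⟨hF, hx0, hxδ⟩
    have hρx : ρ x = NodalPencil.satRadius n d i Θ R''' R'' x.1 := NodalPencil.monodromyMap_cutRadius_eq b₀ Θ hρW hR hTR hT0 hδ₀ hxδ
    exact ⟨by rw [hρx]; exact hF, hx0⟩
  · intro s x hx0 hxδ hF
    have hρx : ρ x = NodalPencil.satRadius n d i Θ R''' R'' x.1 := NodalPencil.monodromyMap_cutRadius_eq b₀ Θ hρW hR hTR hT0 hδ₀ hxδ
    have hρT : ρ x < T := by rw [hρx]; exact hF
    obtain ⟨hpc, hρH, hH0, hH1⟩ := apply_shellHomotopy' hs₀₁' hlam₀ hI hG0 hGO hGρ s hxδ hx0 hρT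
    have hnorm : ‖pc (G (2 * π * s * lam (ρ x), J (2 * π * (1 - s * lam (ρ x)), x)))‖ < δ₀ := by rw [hpc]; exact hxδ
    have hρh := NodalPencil.monodromyMap_cutRadius_eq b₀ Θ hρW hR hTR hT0 hδ₀ hnorm
    refine ⟨hpc, hρh.symm.trans (hρH.trans hρx), ?_, fun hF' => hH1 (by rw [hρx]; exact hF')⟩
    change (G (2 * π * (0 : ℝ) * lam (ρ x), J (2 * π * (1 - (0 : ℝ) * lam (ρ x)), x))).1 = _
    rw [hH0]
    obtain ⟨hF', hcρ⟩ := NodalPencil.monodromyMap_good_of_cutRadius_lt b₀ Θ hρW hρT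
    exact monodromyMap_model_coe a ha hd b₀ Φ hΦ hΦs hΦt Θ hr φ hφ hΘφ hns hR hTR hTr hF' hx0 hcρ (2 * π)

end MonodromyMap

end WeightedPencil

end Literature.AlgebraicGeometry.HodgeTheory

end
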